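import Summits.RiemannHypothesis.RiemannHypothesis.Theorems.PfPersistenceF3DeletionTwins
import Summits.RiemannHypothesis.RiemannHypothesis.Theorems.PfPersistenceF3SharpLocalDatum
import Summits.RiemannHypothesis.RiemannHypothesis.Theorems.PfPersistenceF5TailTwins
import Literature.NumberTheory.LFunctions.WeilWindowSimpleEven
import Literature.NumberTheory.LFunctions.WeilMellinBounds
import HarnessLib

/-!
# F3 — tame explicit data: the linear-functional layer over `ExplicitDatum` — pub-rhpf fake-3, gen 5

HONEST FRAMING: mechanism/rigidity campaign; no RH claims.  Nothing here asserts that any L-function is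
Weil-positive; this file is pure bookkeeping for the record `ExplicitDatum` of
`PfPersistenceBarrierExplicitDatum` (smooth part, positions, weights).

The record carries an ARBITRARY smooth part `(ℝ → ℂ) → ℂ` and a `tsum` prime term, so by itself it
supports no linear algebra: this is the gap the gen-2 note on THEOREM F3-B recorded ("bilinearity and
translation invariance of the host's Weil form have nothing to hold on to").  We supply the missing layer
as an explicit, checkable hypothesis `ExplicitDatum.IsTame E`:
* the smooth part is ADDITIVE on Weil test kernels, and
* only finitely many positions lie in any bounded set (every prime term of a compactly supported kernel
  is a finite sum, `primeTerm_eq_sum`),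
and prove: additivity of `W_E` on test kernels with a common support bound (`functional_add`);
translation invariance `Q_E(τ_c g) = Q_E(g)` (automatic: `Q_E` sees `g` only through `A_g = g ⋆ g̃`,
`quadratic_translate`); the deletion formula `W_{E∖S}(k) = W_E(k) + Σ_{i∈S visible} wtᵢ (k(posᵢ) + k(-posᵢ))`
(`deleteMasses_functional_eq`); the parallelogram law for autocorrelation FUNCTIONS
`A_{u+v} + A_{u-v} = 2A_u + 2A_v` (`autocorr_add_real_mul`, `autocorr_parallelogram`, from the public
bilinearity lemmas of `Literature/…/WeilWindowSimpleEven`); and tameness of `zetaDatum`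
(`weilMellin_add`, `weilArchIntegral_add`; positions `log n`), of the FE-honest `S♯` twins
`sharpLocalDatum p b` of `PfPersistenceF3SharpLocalDatum`, and of every deletion of a tame datum.
Consumer: `PfPersistenceF3DeletionDichotomy` (THEOREM F3-B for every tame host).
-/

set_option linter.dupNamespace false

noncomputable section

open MeasureTheory Set Filter Complex
open scoped Real Topology ComplexConjugate

namespace Summit.RiemannHypothesis.RiemannHypothesis.Theorems.PfPersistenceBarrier

open Literature.NumberTheory.LFunctions
open Summit.RiemannHypothesis.RiemannHypothesis.Theorems.PfPersistenceF5TailTwins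
  (twin twin_eq_add isWeilTest_twin tsupport_twin_subset tsupport_add_mul_subset
   weilConv_weilReflect_translate weilConv_weilReflect_twin_two_mul weilConv_weilReflect_twin_neg_two_mul)
-- `translate`, `isWeilTest_translate`, `tsupport_translate_subset` are written with the prefix
-- `PfPersistenceF5TailTwins.` below (Mathlib's `_root_.translate` and the Literature lemmas of the same
-- names for `t ↦ g (t + c)` would otherwise be ambiguous).

namespace ExplicitDatum

variable {E : ExplicitDatum} {S : Set ℕ}

/-! ## The linear-functional layer: tame data -/

/-- A datum is TAME when its smooth part is additive on Weil test kernels and its positions are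
locally finite (finitely many of modulus `≤ R` for every `R`).  `zetaDatum`, the `S♯` twins
`sharpLocalDatum p b` and all their deletions are tame (below). [folklore] -/
def IsTame (E : ExplicitDatum) : Prop :=
  (∀ k₁ k₂ : ℝ → ℂ, IsWeilTest k₁ → IsWeilTest k₂ → E.smooth (k₁ + k₂) = E.smooth k₁ + E.smooth k₂) ∧
    ∀ R : ℝ, {i : ℕ | |E.pos i| ≤ R}.Finite

/-- Additivity of the smooth part of a tame datum on test kernels. [folklore] -/
theorem IsTame.smooth_add (hE : E.IsTame) (k₁ k₂ : ℝ → ℂ) (hk₁ : IsWeilTest k₁) (hk₂ : IsWeilTest k₂) :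
    E.smooth (k₁ + k₂) = E.smooth k₁ + E.smooth k₂ :=
  hE.1 k₁ k₂ hk₁ hk₂

/-- Local finiteness of the positions of a tame datum. [folklore] -/
theorem IsTame.finite_below (hE : E.IsTame) (R : ℝ) : {i : ℕ | |E.pos i| ≤ R}.Finite :=
  hE.2 R

/-- The prime term of a kernel supported in `[-R, R]` is a finite sum over any finset containing the
indices of position `≤ R` in modulus. [folklore] -/
theorem primeTerm_eq_sum (E : ExplicitDatum) {k : ℝ → ℂ} {R : ℝ} (hk : tsupport k ⊆ Icc (-R) R)
    {T : Finset ℕ} (hT : ∀ i, |E.pos i| ≤ R → i ∈ T) :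
    E.primeTerm k = ∑ i ∈ T, E.wt i * (k (E.pos i) + k (-E.pos i)) := by
  unfold primeTerm
  refine tsum_eq_sum fun i hi ↦ ?_
  have hi' : R < |E.pos i| := not_le.mp fun h ↦ hi (hT i h)
  rw [apply_eq_zero_of_tsupport_subset hk hi',
    apply_eq_zero_of_tsupport_subset hk (by rwa [abs_neg]), add_zero, mul_zero]

/-- Support of a sum of two functions supported in a closed set. [folklore] -/
theorem tsupport_add_subset {u v : ℝ → ℂ} {s : Set ℝ} (hsc : IsClosed s) (hu : tsupport u ⊆ s)
    (hv : tsupport v ⊆ s) : tsupport (u + v) ⊆ s := by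
  have h := tsupport_add_mul_subset hsc hu hv 1
  have e : (u + fun x ↦ (1 : ℂ) * v x) = u + v := by funext x; simp
  rwa [e] at h

/-- Additivity of the functional of a tame datum on test kernels with a common support bound. [folklore] -/
theorem functional_add (hE : E.IsTame) {k₁ k₂ : ℝ → ℂ} (hk₁ : IsWeilTest k₁) (hk₂ : IsWeilTest k₂)
    {R : ℝ} (hs₁ : tsupport k₁ ⊆ Icc (-R) R) (hs₂ : tsupport k₂ ⊆ Icc (-R) R) :
    E.functional (k₁ + k₂) = E.functional k₁ + E.functional k₂ := by
  have hs : tsupport (k₁ + k₂) ⊆ Icc (-R) R := tsupport_add_subset isClosed_Icc hs₁ hs₂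
  have hT : ∀ i, |E.pos i| ≤ R → i ∈ (hE.finite_below R).toFinset :=
    fun i h ↦ (hE.finite_below R).mem_toFinset.mpr h
  unfold functional
  rw [hE.smooth_add k₁ k₂ hk₁ hk₂, E.primeTerm_eq_sum hs hT, E.primeTerm_eq_sum hs₁ hT,
    E.primeTerm_eq_sum hs₂ hT]
  have hsplit : ∑ i ∈ (hE.finite_below R).toFinset,
      E.wt i * ((k₁ + k₂) (E.pos i) + (k₁ + k₂) (-E.pos i)) =
        ∑ i ∈ (hE.finite_below R).toFinset, E.wt i * (k₁ (E.pos i) + k₁ (-E.pos i)) +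
          ∑ i ∈ (hE.finite_below R).toFinset, E.wt i * (k₂ (E.pos i) + k₂ (-E.pos i)) := by
    rw [← Finset.sum_add_distrib]
    refine Finset.sum_congr rfl fun i _ ↦ ?_
    simp only [Pi.add_apply]
    ring
  rw [hsplit]
  ring

/-- `Q_E(τ_c g) = Q_E(g)`: the form depends on `g` only through the autocorrelation. [folklore] -/
theorem quadratic_translate (E : ExplicitDatum) (c : ℝ) (g : ℝ → ℂ) :
    E.quadratic (PfPersistenceF5TailTwins.translate c g) = E.quadratic g :=
  congrArg E.functional (weilConv_weilReflect_translate c g)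

open Classical in
/-- The functional of a deletion differs from the host's by the deleted visible masses. [folklore] -/
theorem deleteMasses_functional_eq (E : ExplicitDatum) (S : Set ℕ) {k : ℝ → ℂ} {R : ℝ}
    (hk : tsupport k ⊆ Icc (-R) R) {T : Finset ℕ} (hT : ∀ i, |E.pos i| ≤ R → i ∈ T) :
    (E.deleteMasses S).functional k =
      E.functional k + ∑ i ∈ T, (if i ∈ S then E.wt i * (k (E.pos i) + k (-E.pos i)) else 0) := by
  unfold functional
  rw [(E.deleteMasses S).primeTerm_eq_sum hk hT, E.primeTerm_eq_sum hk hT]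
  simp only [deleteMasses_smooth, deleteMasses_pos]
  have : ∀ i ∈ T, (E.deleteMasses S).wt i * (k (E.pos i) + k (-E.pos i)) =
      E.wt i * (k (E.pos i) + k (-E.pos i)) -
        (if i ∈ S then E.wt i * (k (E.pos i) + k (-E.pos i)) else 0) := by
    intro i _
    by_cases h : i ∈ S
    · rw [deleteMasses_wt_of_mem h, if_pos h]; ring
    · rw [deleteMasses_wt_of_not_mem h, if_neg h]; ring
  rw [Finset.sum_congr rfl this, Finset.sum_sub_distrib]
  ring

/-! ## Parallelogram law for autocorrelations -/

/-- `A_{u + t v} = A_u + t (u ⋆ ṽ + v ⋆ ũ) + t² A_v` for a real scalar `t`. [folklore] -/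
theorem autocorr_add_real_mul {u v : ℝ → ℂ} (hu : IsWeilTest u) (hv : IsWeilTest v) (t : ℝ) :
    weilConv (u + fun x ↦ (t : ℂ) * v x) (weilReflect (u + fun x ↦ (t : ℂ) * v x)) =
      weilConv u (weilReflect u) +
        (fun x ↦ (t : ℂ) * (weilConv u (weilReflect v) x + weilConv v (weilReflect u) x)) +
        fun x ↦ ((t ^ 2 : ℝ) : ℂ) * weilConv v (weilReflect v) x := by
  have htv : IsWeilTest (fun x ↦ (t : ℂ) * v x) := hv.const_mul _
  rw [weilReflect_add, weilConv_add_left hu htv (hu.weilReflect.add htv.weilReflect),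
    weilConv_add_right hu hu.weilReflect htv.weilReflect,
    weilConv_add_right htv hu.weilReflect htv.weilReflect, weilReflect_const_mul,
    Complex.conj_ofReal, weilConv_const_mul_right, weilConv_const_mul_left, weilConv_const_mul_left,
    weilConv_const_mul_right]
  funext x
  simp only [Pi.add_apply]
  push_cast
  ring

/-- The parallelogram law `A_{u+v} + A_{u-v} = 2 A_u + 2 A_v`. [folklore] -/
theorem autocorr_parallelogram {u v : ℝ → ℂ} (hu : IsWeilTest u) (hv : IsWeilTest v) :
    weilConv (u + fun x ↦ ((1 : ℝ) : ℂ) * v x) (weilReflect (u + fun x ↦ ((1 : ℝ) : ℂ) * v x)) +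
      weilConv (u + fun x ↦ ((-1 : ℝ) : ℂ) * v x)
        (weilReflect (u + fun x ↦ ((-1 : ℝ) : ℂ) * v x)) =
      (weilConv u (weilReflect u) + weilConv u (weilReflect u)) +
        (weilConv v (weilReflect v) + weilConv v (weilReflect v)) := by
  rw [autocorr_add_real_mul hu hv 1, autocorr_add_real_mul hu hv (-1)]
  funext x
  simp only [Pi.add_apply]
  push_cast
  ring

/-! ## Tame instances: `ζ`, the `S♯` twins, deletions -/

/-- Deleting masses keeps a datum tame. [folklore] -/
theorem IsTame.deleteMasses (hE : E.IsTame) (S : Set ℕ) : (E.deleteMasses S).IsTame :=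
  ⟨hE.smooth_add, hE.finite_below⟩

/-- Only finitely many `n : ℕ` have `|log n| ≤ R`. [folklore] -/
theorem finite_abs_log_le (R : ℝ) : {n : ℕ | |Real.log n| ≤ R}.Finite := by
  refine (Finset.range (⌊Real.exp R⌋₊ + 1)).finite_toSet.subset fun n hn ↦ ?_
  have hn' : |Real.log n| ≤ R := hn
  simp only [Finset.coe_range, mem_Iio]
  rcases Nat.eq_zero_or_pos n with h0 | hp
  · omega
  · have h1 : Real.log n ≤ R := (le_abs_self _).trans hn'
    have h2 : (n : ℝ) ≤ Real.exp R := by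
      rwa [Real.log_le_iff_le_exp (by exact_mod_cast hp)] at h1
    have h3 : n ≤ ⌊Real.exp R⌋₊ := Nat.le_floor h2
    omega

/-- `ζ`'s datum is tame: `ĝ(0) + ĝ(1) + W_∞(g)` is additive on test kernels (`weilMellin_add`,
`weilArchIntegral_add`) and the positions `log n` are locally finite. [folklore] -/
theorem zetaDatum_isTame : zetaDatum.IsTame := by
  refine ⟨fun k₁ k₂ hk₁ hk₂ ↦ ?_, fun R ↦ finite_abs_log_le R⟩
  show weilPolarTerm (k₁ + k₂) + weilArchTerm (k₁ + k₂) =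
    (weilPolarTerm k₁ + weilArchTerm k₁) + (weilPolarTerm k₂ + weilArchTerm k₂)
  have hM := weilMellin_add hk₁.1.continuous hk₁.2 hk₂.1.continuous hk₂.2
  simp only [weilPolarTerm, weilArchTerm, hM, weilArchIntegral_add hk₁ hk₂, Pi.add_apply]
  ring

/-- The FE-honest `S♯` twins `F_{p,b} = ζ·(1 + b p^{-s} + p^{1-2s})` of fake-3 are tame (their smooth
part is `ζ`'s plus the conductor term `2 log p · k(0)`). [folklore] -/
theorem sharpLocalDatum_isTame (p : ℕ) (b : ℝ) : (sharpLocalDatum p b).IsTame := by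
  refine ⟨fun k₁ k₂ hk₁ hk₂ ↦ ?_, fun R ↦ finite_abs_log_le R⟩
  show zetaDatum.smooth (k₁ + k₂) + 2 * Real.log p * (k₁ + k₂) 0 =
    (zetaDatum.smooth k₁ + 2 * Real.log p * k₁ 0) + (zetaDatum.smooth k₂ + 2 * Real.log p * k₂ 0)
  rw [zetaDatum_isTame.smooth_add k₁ k₂ hk₁ hk₂, Pi.add_apply]
  ring

end ExplicitDatum

end Summit.RiemannHypothesis.RiemannHypothesis.Theorems.PfPersistenceBarrier

end
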